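import Summits.BirchSwinnertonDyer.Rank1Residual.ManinAdditive.CMTwinStevensMinimalMembersCor
import HarnessLib

/-!
# CM root `Γ₁(N)`-law at the prime `2` beyond `ℚ(i)`, `ℚ(√−2)`, `ℚ(√−3)`: `K = ℚ(√−7)` (`2` SPLIT) and the five
# inert-`2` fields `ℚ(√−11)`, `ℚ(√−19)`, `ℚ(√−43)`, `ℚ(√−67)`, `ℚ(√−163)` — THEOREM 45 transferred to WILD level
# `k₂ ∈ {2, 3}` (cell `bsd-f2-manin`, planner `es` g32, MEMO-es §50; FILE A⁵ = this file, lands after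
# `…CMTwinStevensMinimalMembersCor`, independent of `CMGammaOneRootLawBeyondQi` / `…InertThree` / `…SplitThree`)

TYPER NOTE (typer g21, T-es-55).  SOURCE = HOME/es/g32/TwoLocalBeyond-es-g32.lean sha16 3614792526fe1851 (148 l.; es: farm rc 0 · 0 err ·
0 warn · 0 s∗rry DIRECT at 17:09Z; typer: own farm check rc 0 · 0 warnings) VERBATIM except this note.  Continues ns
`…ManinAdditive.KatoCurve.CMTwinMinimal` as FILE A⁵ (FILE A = `CMTwinStevensMinimalMembers` p729412 + `…Cor` p729422; siblings A′
`CMGammaOneRootLawBeyondQi` p732179, A‴ `CMGammaOneRootLawInertThree` p732653, A⁗ `CMGammaOneRootLawSplitThree` p733840 — all independent;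
this file imports `…CMTwinStevensMinimalMembersCor` + HarnessLib only, route-independent).  `@[conjecture]` (es's own tags) on the cell rows
**E-es-159 `CMGammaOneRootLawTwoLocalJSqrt7`** (root Γ₁(N)-law, 2-local, on the ℚ(√−7)-CM slice j = −3375, 4 ∣ N; es: THEOREM 48 (μ) = THEOREM 45
at the SPLIT ordinary prime 2 of ℚ(√−7), wild level k ∈ {2,3}, PAPER and CONDITIONAL on the STEP-4 transfer to the ordinary place — audits
R-es-75/R-es-76 PENDING at landing) and **E-es-160 `CMGammaOneRootLawTwoLocalJInertTwo`** (same law on the five inert-2 CM slices j = j_K,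
K ∈ {ℚ(√−11), ℚ(√−19), ℚ(√−43), ℚ(√−67), ℚ(√−163)}; es: THEOREM 48 (ν), PAPER, THEOREM 45's audited supersingular STEP 4 with new wild inputs
d = 8, 62 and v(t_β) = 1/((q−1)q^{k−1}), q = 4 — audit R-es-76 PENDING) ⇒ obligation nodes.  PROVED here (es, kernel-checked): COR 50.S ×2
`not_two_dvd_maninConstant₁_on_cmCurve_sqrtNegSeven/inertTwo_of_rootLawAtTwo` (Stevens' 2 ∤ c₁ at the X₁(N)-optimal curve) and COR 50.R ×2
`not_two_dvd_maninConstant_on_cmCurve_sqrtNegSeven/inertTwo_of_rootLawAtTwo` (C2's 2 ∤ c₀ for lattice-optimal X₀-data given a second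
traceless prime q ≠ 2, q² ∣ N — q = 7 resp. q = |d_K| always available on these classes), law applied at the curve itself.  With E-es-152₂
(ℚ(i), + SHAPE₂⁺ p733627), E-es-154 (ℚ(√−2)) and E-es-155 (ℚ(√−3) at 2) (p732179) this completes es's typed CM locus of C2's domain (4 ∣ N)
over the nine class-number-one fields modulo residual R50 (order-2 members j = 16581375 of ℚ(√−7)-classes for the c₁ form; D-es-g32-4 (c)).
NOT IN PRINT (es): Stevens' c₁-law / Manin at 2 on CM classes at wild level is not a printed theorem; THEOREM 48 (μ)/(ν) are cell paper
claims.  BC5 (es, MEMO-es §50 = HOME/es/g32/MEMO-es-sec50.md 8bba7434f5389b94): CENSUS-P2H-v1 bd456d5b44aa4ded (54 ℚ(√−7) classes + 81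
inert-field classes N < 5·10⁵, v₂(N) ∈ {0,4,6} in 135/135, 17 + 30 with 4 ∣ N, δ_pred = 0 in 47/47); witnesses ENGINEA-G1-p2-v1
efed99bdbf77d8dc (949 + 713 nonzero Γ₁(N)-periods on 8 + 9 curves, all 2-integral at the primes over 2 — 0 violations), ENGINEC-H2-v1
41c5c8a6d710ffb4 (class formula = engine A to 3.9·10⁻¹² in 57/57, root law 57/57, sharp 31); data ask D-es-g32-4 open.  CHEAPEST
FALSIFIER: one non-2-integral Γ₁(N)-period on a listed CM curve with 4 ∣ N (0/1662 so far).  REFUTER VERDICTS: ref1 R-es-76 PENDING; ref2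
PENDING.  Typer checks: the six decl names fresh tree-wide; no `[cite:]` keys; no instances, no notation; 148 + note < 400 lines.
PARTITION 0 · beyond-print theorem: no (paper candidates, conditional) · bears_on stmt-BirchSwinnertonDyer-22967 (C2) · BSD is not proved
by this; E-es-159/160, C2 OPEN.

Contents: two conjecture nodes (E-es-159 `CMGammaOneRootLawTwoLocalJSqrt7`, E-es-160 `CMGammaOneRootLawTwoLocalJInertTwo`)
and COR 50: Stevens' `2 ∤ c₁` and C2's `2 ∤ c₀` on every elliptic curve over `ℚ` with `4 ∣ N` and CM by `ℤ[(1+√−7)/2]`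
(`j = −3375`) or by the maximal order of one of the five inert-`2` fields (law applied at the curve itself; over these
six fields the `X₀(N)`-optimal curve has `j = j_K` in 135/135 classes `N < 5·10⁵`, CENSUS-P2H-v1).  With E-es-152₂
(`ℚ(i)`), E-es-154 (`ℚ(√−2)`), E-es-155 (`ℚ(√−3)` at `2`) this makes the typed CM locus of C2's domain (`4 ∣ N`) complete over
the nine class-number-one fields up to order members (`ℚ(√−7)`: the `2`-isogenous members `j = 16581375` are reached
class-wise by Stevens-minimality transport, not typed here).
Status of the laws: THEOREM 48 (μ) (`ℚ(√−7)`, split, ordinary: CONDITIONAL on the STEP-4 transfer to the ordinary place as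
THEOREM 48 (λ), audit asks R-es-75/R-es-76) and THEOREM 48 (ν) (inert, supersingular: THEOREM 45's audited setting; the new
inputs are the wild conductor-discriminant exponents `d = 8, 62` and `v(t_β) = 1/((q−1)q^{k−1})`, `q = 4`, audit ask
R-es-76) — PAPER; kernel status: conjecture nodes.
Witnesses (MEMO-es §50): CENSUS-P2H-v1 (`v₂(N) ∈ {0, 4, 6}` in 135/135 classes, `δ_pred = 0` in 47/47 classes with `4 ∣ N`);
engine A (`Γ₁(N)`-periods at the primes over `2`: 949 + 713 nonzero periods on 8 + 9 curves, all `2`-integral,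
ENGINEA-G1-p2-v1); engine C at level `k ∈ {2, 3}` on 15 curves covering all six fields (class formula = engine A to
`3.9·10⁻¹²` in 57/57, root law 57/57, sharp 31, different bound `v_{𝔓_R}(G(1)) ≥ j_k` in 61/61, ENGINEC-H2-v1).  PARTITION 0 · beyond-print theorem: no ·
bears_on stmt-BirchSwinnertonDyer-22967 (C2) · BSD is not proved by this.
-/

set_option autoImplicit false

noncomputable section

namespace Summit.BirchSwinnertonDyer.Rank1Residual.ManinAdditive.KatoCurve.CMTwinMinimal

open Complex Polynomial WeierstrassCurve Literature.NumberTheory.EllipticCurves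
  Literature.NumberTheory.EllipticCurves.ModularForms
  Summit.BirchSwinnertonDyer.Rank1Residual.ManinAdditive.KatoCurve.CMOptimal
  Summit.BirchSwinnertonDyer.Rank1Residual.ManinAdditive.KatoCurve.CMOptimal.TwinLattice

/-! ## §10 The prime `2` on `ℚ(√−7)` (split) and on the five inert-`2` fields (MEMO-es §50)

THEOREM 48 (μ) (paper, conditional): `K = ℚ(√−7)`, `(2) = 𝔭 𝔭̄`, `N𝔭 = 2`, `O^× = {±1}`; `k = f(ε_𝔭) = f(ε_𝔭̄) ∈ {0, 2, 3}`
(`k = 1` impossible: `(O/𝔭)^× = 1`; `U₁/U₃ ≅ (ℤ/8)^×`, `ε` `±1`-valued), so `v₂(N) = 2k ∈ {0, 4, 6}` (census 37/9/8 of 54);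
`k = 2`: `(O/4)^×/±1 = 1`, `R₂ = K`, `(h, d, e) = (1, 0, 1)`, `ν = v₂(Δ_min)/12 = 1`, `τ = v(t_β) = 1/2`, `j = 2 = k`, `δ = 0`;
`k = 3`: `(ℤ/8)^×/±1 ≅ ℤ/2`, `(h, d, e) = (2, 3, 2)` (`R₃ ⊗ K_𝔭 = ℚ₂(√2)`), `ν = 3/2`, `τ = 1/4`, `j = 4`, `⌊(4+3)/2⌋ = 3 = k`, `δ = 0`.
THEOREM 48 (ν) (paper): `K` inert at `2`, `O/2 = 𝔽₄`, `O^× = {±1}`; `k ∈ {0, 2, 3}` (`(O/2)^×` has odd order), `v₂(N) ∈ {0, 4, 6}`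
(census 51/14/16 of 81); `e = h`, `v(t_β) = 1/((q−1)q^{k−1})`, `q = 4`;
`k = 2`: `(O/4)^×/±1 ≅ ℤ/6`, `(h, d, e) = (6, 8, 6)`, `ν = 1`, `τ = 1/12`, `j = 7`, `⌊(7+8)/6⌋ = 2 = k`, `δ = 0`;
`k = 3`: `|(O/8)^×/±1| = 24`, `(h, d, e) = (24, 62, 24)`, `ν = 1/2`, `τ = 1/48`, `j = 13`, `⌊(13+62)/24⌋ = 3 = k`, `δ = 0`. -/

section TwoLocalBeyond

open CongruenceSubgroup
open scoped MatrixGroups ModularForm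

variable {N : ℕ} [NeZero N]

/-- **E-es-159 — root `Γ₁(N)`-law on the `ℚ(√−7)`-CM slice, `2`-local** (THEOREM 48 (μ): `(2) = 𝔭 𝔭̄` split in
`ℚ(√−7)`, wild level `k ∈ {2, 3}` at both primes, `(h, d, e) = (1, 0, 1)` resp. `(2, 3, 2)`, `δ = 0`): for every globally
minimal `V` with `j(V) = −3375` and `4 ∣ N`, every newform `f` of its class and its Néron lattice `L`, `Λ₁(f) ⊆ L ⊗ ℤ₍₂₎`.
Why it might fail: the place is ORDINARY and WILD — THEOREM 45's STEP 4 was audited (REF1 §R163) at supersingular places;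
the transfer rests on `Ê(𝔪_𝔓)_tors = V[𝔭^∞]` at `𝔓 ∣ 𝔭` and on `v(t_β) = 1/2^{k−1}` (height-one Lubin–Tate `ℤ₂`-module),
unaudited (R-es-75/76); `k = 3` also uses the conductor-discriminant count `d = 3` for `K(8)/K`.
[B] es g32 MEMO-es §50; census 54 classes `N < 5·10⁵`, 17 with `4 ∣ N` (CENSUS-P2H-v1); witnesses ENGINEA-G1-p2-v1 (949
nonzero `Γ₁(N)`-periods on 8 curves, all `2`-integral at `𝔭` and `𝔭̄`), ENGINEC-H2-v1 (engine C at `𝔭` and `𝔭̄`, `k = 2, 3`). -/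
@[conjecture]
def CMGammaOneRootLawTwoLocalJSqrt7 : Prop :=
  ∀ (V : WeierstrassCurve ℚ) [V.IsElliptic] [V.IsGloballyMinimal] {N : ℕ} [NeZero N]
    (f : CuspForm (Gamma0 N) 2) (L : PeriodPair),
    V.j = -3375 → 2 ^ 2 ∣ N → IsNewformOf V f → IsNeronLatticeOf (V.baseChange ℂ) L →
    ∀ z ∈ periodLatticeGamma1 f, ∃ s : ℤ, ¬ (2 : ℤ) ∣ s ∧ (s : ℂ) * z ∈ L.lattice

/-- **E-es-160 — root `Γ₁(N)`-law on the inert-`2` CM slices, `2`-local** (THEOREM 48 (ν): `K ∈ {ℚ(√−11), ℚ(√−19),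
ℚ(√−43), ℚ(√−67), ℚ(√−163)}`, `(2)` inert, supersingular, wild level `k ∈ {2, 3}`, `(h, d, e) = (6, 8, 6)` resp.
`(24, 62, 24)`, `δ = 0`): for every globally minimal `V` with `j(V) = j_K` and `4 ∣ N`, every newform `f` of its class and
its Néron lattice `L`, `Λ₁(f) ⊆ L ⊗ ℤ₍₂₎`.
Why it might fail: the margin is the wild different — `δ = 0` needs `j + d ≥ k·h`, i.e. `d ≥ 5` (`k = 2`) and `d ≥ 59`
(`k = 3`, computed `d = 62`, margin 3); a miscount of the conductors of `(O/8)^×/±1` (24 characters) or a smaller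
`v(t_β)` than `1/((q−1)q^{k−1})` would break `k = 3` first (R-es-76).
[B] es g32 MEMO-es §50; census 81 classes `N < 5·10⁵`, 30 with `4 ∣ N` (CENSUS-P2H-v1); witnesses ENGINEA-G1-p2-v1 (713
nonzero `Γ₁(N)`-periods on 9 curves over `ℚ(√−11)`, `ℚ(√−19)`, `ℚ(√−43)`, all `2`-integral), ENGINEC-H2-v1 (engine C on
all five fields; `k = 2`: `v_{𝔓_R}(G(1)) ≥ 8 > 7 = j`; `k = 3`: `∈ {14, 18} ≥ 13`, trace lemma tight at
`⌊(14+62)/24⌋ = 3`; root law 25/25 rows with `D ≠ 0`, sharp 11). -/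
@[conjecture]
def CMGammaOneRootLawTwoLocalJInertTwo : Prop :=
  ∀ (V : WeierstrassCurve ℚ) [V.IsElliptic] [V.IsGloballyMinimal] {N : ℕ} [NeZero N]
    (f : CuspForm (Gamma0 N) 2) (L : PeriodPair),
    (V.j = -32768 ∨ V.j = -884736 ∨ V.j = -884736000 ∨ V.j = -147197952000 ∨ V.j = -262537412640768000) →
    2 ^ 2 ∣ N → IsNewformOf V f → IsNeronLatticeOf (V.baseChange ℂ) L →
    ∀ z ∈ periodLatticeGamma1 f, ∃ s : ℤ, ¬ (2 : ℤ) ∣ s ∧ (s : ℂ) * z ∈ L.lattice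

/-- **COR 50.S (√−7) — Stevens at `2` on the `ℚ(√−7)`-CM slice**: the `X₁(N)`-optimal curve `W` with `j(W) = −3375` and
`4 ∣ N` has `2 ∤ c₁` (law applied at `W` itself). -/
theorem not_two_dvd_maninConstant₁_on_cmCurve_sqrtNegSeven_of_rootLawAtTwo (h : CMGammaOneRootLawTwoLocalJSqrt7)
    (W : WeierstrassCurve ℚ) [W.IsElliptic] [W.IsGloballyMinimal] (D : Gamma1ParametrizationData W N)
    (hopt : D.IsOptimal) (hj : W.j = -3375) (hN : 2 ^ 2 ∣ N) : ¬ (2 : ℤ) ∣ D.maninConstant :=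
  not_dvd_maninConstant₁_of_rootLaw_of_witness D hopt (h W D.f D.L hj hN D.isNewformOf D.isNeronLattice)
    (exists_primitive_witness D.L 2)

/-- **COR 50.R (√−7) — C2 for `X₀(N)`-data on the `ℚ(√−7)`-CM slice** with a second traceless prime `q ≠ 2`, `q² ∣ N`
(always available: `q = 7`, `49 ∣ N` in 54/54 classes). -/
theorem not_two_dvd_maninConstant_on_cmCurve_sqrtNegSeven_of_rootLawAtTwo (h : CMGammaOneRootLawTwoLocalJSqrt7)
    (W : WeierstrassCurve ℚ) [W.IsElliptic] [W.IsGloballyMinimal] (D : ModularParametrizationData W N)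
    (hD : ∀ z ∈ D.L.lattice, ∃ w ∈ periodLattice D.f, z = D.c * w)
    (hj : W.j = -3375) {q : ℕ} (hq : q.Prime) (hq2 : q ≠ 2) (hN : 2 ^ 2 ∣ N) (hqN : q ^ 2 ∣ N) :
    ¬ (2 : ℤ) ∣ D.maninConstant := by
  have hfW : IsNewformOf W D.f := D.isNewformOf
  have heq := ModularForms.gamma1LatticeEqOfTwoTracelessPrimes_holds N D.f hfW.1 2 q Nat.prime_two hq
    (Ne.symm hq2) ((dvd_pow_self 2 two_ne_zero).trans hN) ((dvd_pow_self q two_ne_zero).trans hqN)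
    (hfW.1.cuspCoeff_eq_zero_of_sq_dvd Nat.prime_two hN) (hfW.1.cuspCoeff_eq_zero_of_sq_dvd hq hqN)
  obtain ⟨z, hz, hzM⟩ := exists_primitive_witness D.L 2
  refine not_dvd_maninConstant_of_saturated_mem_of_witness D hD Int.prime_two D.L.lattice
    (fun γ => h W D.f D.L hj hN hfW D.isNeronLattice _ ?_) ⟨z, hz, fun s hs m hm => ?_⟩
  · rw [heq]; unfold periodLattice; exact AddSubgroup.subset_closure ⟨γ, rfl⟩
  · exact_mod_cast hzM s hs m hm

/-- **COR 50.S (inert 2) — Stevens at `2` on the inert-`2` CM slices**: the `X₁(N)`-optimal curve `W` with `j(W) = j_K`,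
`K ∈ {ℚ(√−11), ℚ(√−19), ℚ(√−43), ℚ(√−67), ℚ(√−163)}`, and `4 ∣ N` has `2 ∤ c₁`. -/
theorem not_two_dvd_maninConstant₁_on_cmCurve_inertTwo_of_rootLawAtTwo (h : CMGammaOneRootLawTwoLocalJInertTwo)
    (W : WeierstrassCurve ℚ) [W.IsElliptic] [W.IsGloballyMinimal] (D : Gamma1ParametrizationData W N)
    (hopt : D.IsOptimal)
    (hj : W.j = -32768 ∨ W.j = -884736 ∨ W.j = -884736000 ∨ W.j = -147197952000 ∨ W.j = -262537412640768000)
    (hN : 2 ^ 2 ∣ N) : ¬ (2 : ℤ) ∣ D.maninConstant :=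
  not_dvd_maninConstant₁_of_rootLaw_of_witness D hopt (h W D.f D.L hj hN D.isNewformOf D.isNeronLattice)
    (exists_primitive_witness D.L 2)

/-- **COR 50.R (inert 2) — C2 for `X₀(N)`-data on the inert-`2` CM slices** with a second traceless prime `q ≠ 2`,
`q² ∣ N` (always available: `q = |d_K| ∈ {11, 19, 43, 67, 163}`, `d_K² ∣ N` in 81/81 classes). -/
theorem not_two_dvd_maninConstant_on_cmCurve_inertTwo_of_rootLawAtTwo (h : CMGammaOneRootLawTwoLocalJInertTwo)
    (W : WeierstrassCurve ℚ) [W.IsElliptic] [W.IsGloballyMinimal] (D : ModularParametrizationData W N)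
    (hD : ∀ z ∈ D.L.lattice, ∃ w ∈ periodLattice D.f, z = D.c * w)
    (hj : W.j = -32768 ∨ W.j = -884736 ∨ W.j = -884736000 ∨ W.j = -147197952000 ∨ W.j = -262537412640768000)
    {q : ℕ} (hq : q.Prime) (hq2 : q ≠ 2) (hN : 2 ^ 2 ∣ N) (hqN : q ^ 2 ∣ N) :
    ¬ (2 : ℤ) ∣ D.maninConstant := by
  have hfW : IsNewformOf W D.f := D.isNewformOf
  have heq := ModularForms.gamma1LatticeEqOfTwoTracelessPrimes_holds N D.f hfW.1 2 q Nat.prime_two hq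
    (Ne.symm hq2) ((dvd_pow_self 2 two_ne_zero).trans hN) ((dvd_pow_self q two_ne_zero).trans hqN)
    (hfW.1.cuspCoeff_eq_zero_of_sq_dvd Nat.prime_two hN) (hfW.1.cuspCoeff_eq_zero_of_sq_dvd hq hqN)
  obtain ⟨z, hz, hzM⟩ := exists_primitive_witness D.L 2
  refine not_dvd_maninConstant_of_saturated_mem_of_witness D hD Int.prime_two D.L.lattice
    (fun γ => h W D.f D.L hj hN hfW D.isNeronLattice _ ?_) ⟨z, hz, fun s hs m hm => ?_⟩
  · rw [heq]; unfold periodLattice; exact AddSubgroup.subset_closure ⟨γ, rfl⟩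
  · exact_mod_cast hzM s hs m hm

end TwoLocalBeyond

end Summit.BirchSwinnertonDyer.Rank1Residual.ManinAdditive.KatoCurve.CMTwinMinimal

end
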